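import Summits.QuantumFields.YangMills.Theorems.ComplexCouplingChannelFreeEnergyWindowChannelStubChainOnCompacts
import Summits.QuantumFields.YangMills.Theorems.ComplexCouplingChannelHarmonicMeasureEngineTorusLegPrelims

/-!
# Two-constants estimate along disc chains for LOCAL REAL PARTS, uniformly on compact sets

Stub `stub_reChain` of line `Sketch (transport)` for the crux `FreeEnergyWindowChannel`
(`stmt-QuantumFields-18842`, route `ComplexCouplingChannel` of `QuantumFields/YangMills`).

This is the real-part version of `exists_exponent_norm_le_on_ball` / `stub_chainOnCompacts`
(`ComplexCouplingChannelFreeEnergyWindowChannelStubChainOnCompacts`).  The transported quantity is a real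
function `u` on an open preconnected `D ⊆ ℂ` which is only known to be, on every disc inside `D`, the real
part of SOME holomorphic function (in the line: `u = P⁻⁴ log ‖Z_P‖ − Q⁻⁴ log ‖Z_Q‖`).  Smallness `|u| ≤ ε` on
`D ∩ ball x r₀` and a global bound `|u| ≤ B` (`0 < ε ≤ B`) give `|u| ≤ C₀ ε^θ B^{1-θ}` on any compact `K ⊆ D`,
with `θ ∈ (0, 1]` and `C₀ ≥ 1` depending only on `(D, x, r₀, K)`, not on `u`.

* `abs_re_le_of_bead` — one bead: Borel–Carathéodory (`norm_le_of_re_le_of_norm_zero_le`) twice turns the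
  two real-part bounds into norm bounds (losing a factor `5`), then Hadamard three circles
  (`norm_le_sqrt_of_three_circles`) twice gives `|Re φ| ≤ 5 ε^{1/4} K^{3/4}` on `closedBall c (2ρ)`;
* `exists_exponent_abs_le_on_ball` — the chain of beads from `x` to `β ∈ D` (`θ = 4^{-N}`, `C = 5^N`);
* `stub_reChain` — finite subcover of a compact `K`, least exponent and largest constant over the cover.

References: R. Nevanlinna, *Eindeutige analytische Funktionen* (1936), §III.2 (two-constants theorem);
T. Ransford, *Potential theory in the complex plane* (1995), §4.3; Mathlib `Complex.borelCaratheodory`,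
`Complex.HadamardThreeLines`.
-/

open Complex Metric Set Filter Topology

namespace Summit.QuantumFields.YangMills.Theorems.FreeEnergyWindowChannel

open Summit.QuantumFields.YangMills.Theorems.ComplexCouplingChannel

/-- Exponent bookkeeping of one interpolation step: `(ε^a K^b)^t K^s = ε^{at} K^{1-at}` whenever
`a + b = 1` and `t + s = 1` (`ε, K > 0`). [folklore] -/
theorem rpow_interp_rpow_mul_rpow {ε K a b t s : ℝ} (hε : 0 < ε) (hK : 0 < K) (hab : a + b = 1)
    (hts : t + s = 1) :
    (ε ^ a * K ^ b) ^ t * K ^ s = ε ^ (a * t) * K ^ (1 - a * t) := by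
  -- adapted from `sqrt_interp_mul_sqrt` (tree, DiscChain file)
  have hexp : b * t + s = 1 - a * t := by
    rw [show b = 1 - a by linarith, show s = 1 - t by linarith]; ring
  rw [Real.mul_rpow (Real.rpow_nonneg hε.le _) (Real.rpow_nonneg hK.le _), ← Real.rpow_mul hε.le,
    ← Real.rpow_mul hK.le, mul_assoc, ← Real.rpow_add hK, hexp]

/-- Pulling a common positive factor out of the two-constants interpolant:
`(C X)^t (C B)^s = C (X^t B^s)` whenever `t + s = 1` (`C > 0`, `X, B ≥ 0`). [folklore] -/
theorem mul_rpow_mul_mul_rpow {C X B t s : ℝ} (hC : 0 < C) (hX : 0 ≤ X) (hB : 0 ≤ B)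
    (hts : t + s = 1) :
    (C * X) ^ t * (C * B) ^ s = C * (X ^ t * B ^ s) := by
  have h1 : C ^ t * C ^ s = C := by rw [← Real.rpow_add hC, hts, Real.rpow_one]
  rw [Real.mul_rpow hC.le hX, Real.mul_rpow hC.le hB]
  linear_combination (X ^ t * B ^ s) * h1

/-- **One bead (Borel–Carathéodory twice, then Hadamard three circles twice).**  Let `φ` be holomorphic on
`ball c (8ρ)` with `|Re φ| ≤ K` there and `|Re φ| ≤ ε` on `closedBall c ρ`, where `0 < ε ≤ K`.  Then
`|Re φ z| ≤ 5 ε^{1/4} K^{3/4}` on `closedBall c (2ρ)`.  Proof: for `h := φ - i Im φ(c)` (so that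
`h c = Re φ(c)` is real, of modulus `≤ ε`) Borel–Carathéodory on `ball c (8ρ)` resp. `ball c ρ` gives
`‖h‖ ≤ 5K` on `closedBall c (4ρ)` resp. `‖h‖ ≤ 5ε` on `closedBall c (ρ/2)`; three circles with radii
`(ρ/2, ρ, 2ρ)` and then `(ρ, 2ρ, 4ρ)` give `‖h‖ ≤ ((5ε)^{1/2}(5K)^{1/2})^{1/2}(5K)^{1/2} = 5 ε^{1/4} K^{3/4}`
on `closedBall c (2ρ)`, and `|Re φ| = |Re h| ≤ ‖h‖`. [folklore] -/
theorem abs_re_le_of_bead {φ : ℂ → ℂ} {c : ℂ} {ρ K ε : ℝ} (hρ : 0 < ρ)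
    (hφ : DifferentiableOn ℂ φ (ball c (8 * ρ))) (hK : ∀ z ∈ ball c (8 * ρ), |(φ z).re| ≤ K)
    (hsmall : ∀ z ∈ closedBall c ρ, |(φ z).re| ≤ ε) (hε : 0 < ε) (hεK : ε ≤ K) :
    ∀ z ∈ closedBall c (2 * ρ), |(φ z).re| ≤ 5 * (ε ^ (1 / 4 : ℝ) * K ^ (3 / 4 : ℝ)) := by
  have hK0 : 0 < K := lt_of_lt_of_le hε hεK
  have h5ε : 0 < 5 * ε := by positivity
  have h5K : 0 < 5 * K := by positivity
  have h5εK : 5 * ε ≤ 5 * K := by linarith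
  -- the recentred function `h`, with real centre value `Re φ(c)`
  set h : ℂ → ℂ := fun z => φ z - ((φ c).im : ℂ) * I with hh_def
  have hre : ∀ z, (h z).re = (φ z).re := fun z => by simp [hh_def]
  have hhc : h c = ((φ c).re : ℂ) := Complex.ext (by simp [hh_def]) (by simp [hh_def])
  have hhd : DifferentiableOn ℂ h (ball c (8 * ρ)) := hφ.sub_const _
  have hc0 : ‖h (c + 0)‖ ≤ ε := by
    rw [add_zero, hhc, norm_real, Real.norm_eq_abs]
    exact hsmall c (mem_closedBall_self hρ.le)
  -- its shift to the origin
  have hsh : ∀ R : ℝ, ∀ w ∈ ball (0 : ℂ) R, c + w ∈ ball c R := fun R w hw => by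
    rw [mem_ball, dist_eq_norm, add_sub_cancel_left]; exact mem_ball_zero_iff.1 hw
  have hψd : ∀ R ≤ 8 * ρ, DifferentiableOn ℂ (fun w => h (c + w)) (ball (0 : ℂ) R) := fun R hR =>
    (hhd.mono (ball_subset_ball hR)).comp (differentiableOn_id.const_add c) (hsh R)
  have hre8 : ∀ w ∈ ball (0 : ℂ) (8 * ρ), (h (c + w)).re ≤ K := fun w hw => by
    rw [hre]; exact (le_abs_self _).trans (hK _ (hsh _ w hw))
  have hre1 : ∀ w ∈ ball (0 : ℂ) ρ, (h (c + w)).re ≤ ε := fun w hw => by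
    rw [hre]; exact (le_abs_self _).trans (hsmall _ (ball_subset_closedBall (hsh _ w hw)))
  -- Borel–Carathéodory on `ball c (8ρ)`: `‖h‖ ≤ 5K` on `closedBall c (4ρ)`
  have h45 : (8 * ρ + 3 * (4 * ρ)) / (8 * ρ - 4 * ρ) = 5 := by
    rw [div_eq_iff (sub_pos.2 (by linarith : 4 * ρ < 8 * ρ)).ne']; ring
  have hbig : ∀ z ∈ closedBall c (4 * ρ), ‖h z‖ ≤ 5 * K := by
    intro z hz
    have hzc : ‖z - c‖ ≤ 4 * ρ := by rw [← dist_eq_norm]; exact hz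
    have hBC := norm_le_of_re_le_of_norm_zero_le (R := 8 * ρ) (r := 4 * ρ) (by positivity) (by linarith)
      hK0 (hψd (8 * ρ) le_rfl) hre8 (hc0.trans hεK) hzc
    rw [h45, mul_comm] at hBC
    simpa only [add_sub_cancel] using hBC
  -- Borel–Carathéodory on `ball c ρ`: `‖h‖ ≤ 5ε` on `closedBall c (ρ/2)`
  have h15 : (ρ + 3 * (ρ / 2)) / (ρ - ρ / 2) = 5 := by
    rw [div_eq_iff (sub_pos.2 (by linarith : ρ / 2 < ρ)).ne']; ring
  have hsm : ∀ z ∈ closedBall c (ρ / 2), ‖h z‖ ≤ 5 * ε := by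
    intro z hz
    have hzc : ‖z - c‖ ≤ ρ / 2 := by rw [← dist_eq_norm]; exact hz
    have hBC := norm_le_of_re_le_of_norm_zero_le (R := ρ) (r := ρ / 2) (by positivity) (by linarith)
      hε (hψd ρ (by linarith)) hre1 hc0 hzc
    rw [h15, mul_comm] at hBC
    simpa only [add_sub_cancel] using hBC
  -- three circles with radii `ρ/2, ρ, 2ρ`
  have hsub2 : closedBall c (4 * (ρ / 2)) ⊆ ball c (8 * ρ) := closedBall_subset_ball (by linarith)
  have hmid : ∀ z ∈ closedBall c ρ, ‖h z‖ ≤ (5 * ε) ^ (1 / 2 : ℝ) * (5 * K) ^ (1 / 2 : ℝ) := by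
    intro z hz
    have hz' : z ∈ closedBall c (2 * (ρ / 2)) := by rw [show (2 : ℝ) * (ρ / 2) = ρ by ring]; exact hz
    exact norm_le_sqrt_of_three_circles isOpen_ball hhd (by positivity) hsub2 h5ε h5εK
      (fun w hw => hbig w (closedBall_subset_closedBall (by linarith) hw)) hsm hz'
  -- three circles with radii `ρ, 2ρ, 4ρ`
  have hsub4 : closedBall c (4 * ρ) ⊆ ball c (8 * ρ) := closedBall_subset_ball (by linarith)
  set ε₁ : ℝ := (5 * ε) ^ (1 / 2 : ℝ) * (5 * K) ^ (1 / 2 : ℝ) with hε₁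
  have hε₁0 : 0 < ε₁ := mul_pos (Real.rpow_pos_of_pos h5ε _) (Real.rpow_pos_of_pos h5K _)
  have hε₁K : ε₁ ≤ 5 * K := by
    calc ε₁ ≤ (5 * K) ^ (1 / 2 : ℝ) * (5 * K) ^ (1 / 2 : ℝ) :=
          mul_le_mul_of_nonneg_right (Real.rpow_le_rpow h5ε.le h5εK (by norm_num))
            (Real.rpow_nonneg h5K.le _)
      _ = 5 * K := by rw [← Real.rpow_add h5K]; norm_num
  have halg : ε₁ ^ (1 / 2 : ℝ) * (5 * K) ^ (1 / 2 : ℝ) = 5 * (ε ^ (1 / 4 : ℝ) * K ^ (3 / 4 : ℝ)) := by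
    rw [hε₁, rpow_interp_rpow_mul_rpow (a := 1 / 2) (b := 1 / 2) (t := 1 / 2) (s := 1 / 2) h5ε h5K
      (by norm_num) (by norm_num), show (1 / 2 : ℝ) * (1 / 2) = 1 / 4 by norm_num,
      show (1 : ℝ) - 1 / 4 = 3 / 4 by norm_num,
      mul_rpow_mul_mul_rpow (C := 5) (t := 1 / 4) (s := 3 / 4) (by norm_num) hε.le hK0.le (by norm_num)]
  intro z hz
  have key := norm_le_sqrt_of_three_circles isOpen_ball hhd hρ hsub4 hε₁0 hε₁K hbig hmid hz
  rw [← hre, ← halg]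
  exact (Complex.abs_re_le_norm _).trans key

/-- **Real-part two-constants estimate along a chain of discs, local form.**  Let `D ⊆ ℂ` be open and
preconnected, `x, β ∈ D`, `r₀ > 0`.  There are an exponent `θ ∈ (0, 1]`, a constant `C ≥ 1` and a radius
`s > 0` — depending only on `(D, x, r₀, β)` — such that for every real `u` on `D` which is, on every disc in
`D`, the real part of some holomorphic function, with `|u| ≤ B` on `D` and `|u| ≤ ε` on `D ∩ ball x r₀`
(`0 < ε ≤ B`), one has `|u z| ≤ C ε^θ B^{1-θ}` on `ball β s`.  Proof: the disc chain of
`exists_exponent_norm_le_on_ball` (path from `x` to `β`, thickening inside `D`, radius `ρ = min δ r₀ / 9` so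
that `ball (c j) (8ρ) ⊆ D`, consecutive centres closer than `ρ`), iterating the bead `abs_re_le_of_bead` with
`K_j = 5^j B`, `ε_j = 5^j ε^{(1/4)^j} B^{1-(1/4)^j}`; `θ = 4^{-N}`, `C = 5^N`, `s = ρ`. [folklore] -/
theorem exists_exponent_abs_le_on_ball {D : Set ℂ} (hD : IsOpen D) (hDc : IsPreconnected D)
    {x β : ℂ} (hx : x ∈ D) (hβ : β ∈ D) {r₀ : ℝ} (hr₀ : 0 < r₀) :
    ∃ θ : ℝ, 0 < θ ∧ θ ≤ 1 ∧ ∃ C : ℝ, 1 ≤ C ∧ ∃ s : ℝ, 0 < s ∧ ∀ (u : ℂ → ℝ) (B ε : ℝ),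
      (∀ (c : ℂ) (R : ℝ), 0 < R → ball c R ⊆ D →
        ∃ φ : ℂ → ℂ, DifferentiableOn ℂ φ (ball c R) ∧ ∀ z ∈ ball c R, (φ z).re = u z) →
      0 < ε → ε ≤ B → (∀ z ∈ D, |u z| ≤ B) → (∀ z ∈ D, dist z x < r₀ → |u z| ≤ ε) →
        ∀ z ∈ ball β s, |u z| ≤ C * ε ^ θ * B ^ (1 - θ) := by
  -- adapted from `exists_exponent_norm_le_on_ball` (tree, StubChainOnCompacts file)
  -- a path from `x` to `β` inside `D`
  have hpath : IsPathConnected D := hD.isConnected_iff_isPathConnected.1 ⟨⟨x, hx⟩, hDc⟩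
  have hJ : JoinedIn D x β := hpath.joinedIn x hx β hβ
  set γ : Path x β := hJ.somePath
  have hγD : ∀ t, γ t ∈ D := hJ.somePath_mem
  -- a closed thickening of its compact range inside `D`
  obtain ⟨δ, hδ0, hδD⟩ := (isCompact_range γ.continuous).exists_cthickening_subset_open hD
    (range_subset_iff.2 hγD)
  -- the bead radius
  set ρ : ℝ := min δ r₀ / 9 with hρ
  have hmin : 0 < min δ r₀ := lt_min hδ0 hr₀
  have hρ0 : 0 < ρ := by rw [hρ]; positivity
  have hρδ : 8 * ρ ≤ δ := by rw [hρ]; linarith [min_le_left δ r₀]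
  have hρr : ρ < r₀ := by rw [hρ]; linarith [min_le_right δ r₀]
  -- the spacing of the chain, from uniform continuity of the extended path
  obtain ⟨η, hη0, hη⟩ := Metric.uniformContinuous_iff.1 γ.uniformContinuous_extend ρ hρ0
  obtain ⟨k, hk⟩ := exists_nat_one_div_lt hη0
  set N : ℕ := k + 1 with hN
  have hN0 : (0 : ℝ) < N := by rw [hN]; positivity
  have hNinv : 1 / (N : ℝ) < η := by rw [hN]; push_cast; exact hk
  -- the centres
  set c : ℕ → ℂ := fun j => γ.extend ((j : ℝ) / N) with hc
  have hcmem : ∀ j, c j ∈ range γ := fun j => by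
    rw [← γ.extend_range]; exact mem_range_self _
  have hc0 : c 0 = x := by simp [hc]
  have hcN : c N = β := by
    simp only [hc]
    rw [div_self hN0.ne', Path.extend_one]
  have hstep : ∀ j : ℕ, dist (c (j + 1)) (c j) < ρ := by
    intro j
    refine hη ?_
    rw [Real.dist_eq, Nat.cast_succ, show ((j : ℝ) + 1) / N - j / N = 1 / N from by ring,
      abs_of_pos (by positivity)]
    exact hNinv
  have hball : ∀ j, ball (c j) (8 * ρ) ⊆ D := fun j =>
    ball_subset_closedBall.trans <|
      (closedBall_subset_closedBall hρδ).trans ((closedBall_subset_cthickening (hcmem j) δ).trans hδD)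
  have hin : ∀ j, closedBall (c j) ρ ⊆ ball (c j) (8 * ρ) := fun j =>
    closedBall_subset_ball (by linarith)
  -- the exponent `4^{-N}`, the constant `5^N` and the radius `ρ`
  refine ⟨(1 / 4 : ℝ) ^ N, by positivity, pow_le_one₀ (by norm_num) (by norm_num), 5 ^ N,
    one_le_pow₀ (by norm_num), ρ, hρ0, ?_⟩
  intro u B ε hloc hε hεB hB hsmall
  have hB0 : 0 < B := lt_of_lt_of_le hε hεB
  -- propagation along the chain
  have hind : ∀ j : ℕ, ∀ z ∈ closedBall (c j) ρ,
      |u z| ≤ 5 ^ j * (ε ^ ((1 / 4 : ℝ) ^ j) * B ^ (1 - (1 / 4 : ℝ) ^ j)) := by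
    intro j
    induction j with
    | zero =>
      intro z hz
      simp only [pow_zero, Real.rpow_one, sub_self, Real.rpow_zero, mul_one, one_mul]
      refine hsmall z (hball 0 (hin 0 hz)) ?_
      rw [hc0] at hz
      exact lt_of_le_of_lt hz hρr
    | succ j ih =>
      intro z hz
      set a : ℝ := (1 / 4 : ℝ) ^ j with ha
      have ha0 : 0 ≤ a := by rw [ha]; positivity
      have h5j : (1 : ℝ) ≤ 5 ^ j := one_le_pow₀ (by norm_num)
      have h5j0 : (0 : ℝ) < 5 ^ j := by positivity
      have hX0 : 0 < ε ^ a * B ^ (1 - a) :=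
        mul_pos (Real.rpow_pos_of_pos hε _) (Real.rpow_pos_of_pos hB0 _)
      have hXB : ε ^ a * B ^ (1 - a) ≤ B := by
        calc ε ^ a * B ^ (1 - a) ≤ B ^ a * B ^ (1 - a) :=
              mul_le_mul_of_nonneg_right (Real.rpow_le_rpow hε.le hεB ha0) (Real.rpow_nonneg hB0.le _)
          _ = B := by rw [← Real.rpow_add hB0]; simp
      have hz' : z ∈ closedBall (c j) (2 * ρ) := by
        rw [mem_closedBall]
        calc dist z (c j) ≤ dist z (c (j + 1)) + dist (c (j + 1)) (c j) := dist_triangle _ _ _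
          _ ≤ ρ + ρ := add_le_add hz (hstep j).le
          _ = 2 * ρ := by ring
      -- a local holomorphic function with real part `u` on the bead `ball (c j) (8ρ)`
      obtain ⟨φ, hφd, hφu⟩ := hloc (c j) (8 * ρ) (by positivity) (hball j)
      have hKj : ∀ w ∈ ball (c j) (8 * ρ), |(φ w).re| ≤ 5 ^ j * B := fun w hw => by
        rw [hφu w hw]
        calc |u w| ≤ B := hB w (hball j hw)
          _ = 1 * B := (one_mul B).symm
          _ ≤ 5 ^ j * B := mul_le_mul_of_nonneg_right h5j hB0.le
      have hεj : ∀ w ∈ closedBall (c j) ρ, |(φ w).re| ≤ 5 ^ j * (ε ^ a * B ^ (1 - a)) :=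
        fun w hw => by rw [hφu w (hin j hw)]; exact ih w hw
      have hbead := abs_re_le_of_bead hρ0 hφd hKj hεj (by positivity)
        (mul_le_mul_of_nonneg_left hXB h5j0.le) z hz'
      rw [hφu z ((closedBall_subset_ball (by linarith)) hz'),
        mul_rpow_mul_mul_rpow (t := 1 / 4) (s := 3 / 4) h5j0 hX0.le hB0.le (by norm_num),
        rpow_interp_rpow_mul_rpow (a := a) (b := 1 - a) (t := 1 / 4) (s := 3 / 4) hε hB0 (by ring)
          (by norm_num), ha, ← pow_succ] at hbead
      calc |u z| ≤ 5 * (5 ^ j * (ε ^ ((1 / 4 : ℝ) ^ (j + 1)) * B ^ (1 - (1 / 4 : ℝ) ^ (j + 1)))) := hbead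
        _ = 5 ^ (j + 1) * (ε ^ ((1 / 4 : ℝ) ^ (j + 1)) * B ^ (1 - (1 / 4 : ℝ) ^ (j + 1))) := by ring
  intro z hz
  have hzmem : z ∈ closedBall (c N) ρ := by
    rw [hcN]; exact ball_subset_closedBall hz
  rw [mul_assoc]
  exact hind N z hzmem

/-- **Real-part two-constants estimate along disc chains, with exponent and constant UNIFORM ON A COMPACT
SET** (stub `stub_reChain` of line `Sketch (transport)`, crux `FreeEnergyWindowChannel`).  For an open
preconnected `D ⊆ ℂ`, a point `x ∈ D`, a radius `r₀ > 0` and a compact `K ⊆ D` there are `θ ∈ (0, 1]` and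
`C₀ ≥ 1` (depending only on `D, x, r₀, K`) such that every real function `u` which is, on every disc
`ball c R ⊆ D`, the real part of a holomorphic function, with `|u| ≤ B` on `D` and `|u| ≤ ε ≤ B` on
`D ∩ ball x r₀`, satisfies `|u z| ≤ C₀ ε^θ B^{1-θ}` for ALL `z ∈ K`.  Proof: at every `y ∈ K` the local
chain estimate `exists_exponent_abs_le_on_ball` gives `θ_y, C_y` and a ball `ball y s_y` on which it holds;
finitely many of these balls cover `K` (`IsCompact.elim_nhds_subcover`); take the least `θ_y`
(`Finset.exists_min_image`) and the largest `C_y` (`Finset.exists_max_image`) and use that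
`ε ^ θ * B ^ (1 - θ)` is antitone in `θ` for `ε ≤ B` (`rpow_interp_antitone`).  If the cover is empty then so
is `K` and `θ = C₀ = 1` works. [folklore] -/
theorem stub_reChain :
    ∀ (D : Set ℂ), IsOpen D → IsPreconnected D → ∀ x ∈ D, ∀ r₀ : ℝ, 0 < r₀ →
      ∀ K : Set ℂ, IsCompact K → K ⊆ D →
        ∃ θ : ℝ, 0 < θ ∧ θ ≤ 1 ∧ ∃ C₀ : ℝ, 1 ≤ C₀ ∧
          ∀ (u : ℂ → ℝ) (B ε : ℝ),
            (∀ (c : ℂ) (R : ℝ), 0 < R → Metric.ball c R ⊆ D →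
              ∃ φ : ℂ → ℂ, DifferentiableOn ℂ φ (Metric.ball c R) ∧ ∀ z ∈ Metric.ball c R, (φ z).re = u z) →
            0 < ε → ε ≤ B → (∀ z ∈ D, |u z| ≤ B) → (∀ z ∈ D, dist z x < r₀ → |u z| ≤ ε) →
              ∀ z ∈ K, |u z| ≤ C₀ * ε ^ θ * B ^ (1 - θ) := by
  intro D hD hDc x hx r₀ hr₀ K hK hKD
  -- pointwise data: an exponent, a constant and a radius at every point of `D`
  have hpt : ∀ y ∈ D, ∃ θ : ℝ, 0 < θ ∧ θ ≤ 1 ∧ ∃ C : ℝ, 1 ≤ C ∧ ∃ s : ℝ, 0 < s ∧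
      ∀ (u : ℂ → ℝ) (B ε : ℝ),
        (∀ (c : ℂ) (R : ℝ), 0 < R → ball c R ⊆ D →
          ∃ φ : ℂ → ℂ, DifferentiableOn ℂ φ (ball c R) ∧ ∀ z ∈ ball c R, (φ z).re = u z) →
        0 < ε → ε ≤ B → (∀ z ∈ D, |u z| ≤ B) → (∀ z ∈ D, dist z x < r₀ → |u z| ≤ ε) →
          ∀ z ∈ ball y s, |u z| ≤ C * ε ^ θ * B ^ (1 - θ) :=
    fun y hy => exists_exponent_abs_le_on_ball hD hDc hx hy hr₀
  choose! θ hθ0 hθ1 C hC1 s hs0 hP using hpt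
  -- a finite subcover of `K` by the balls `ball y (s y)`, `y ∈ K`
  obtain ⟨t, htK, hcover⟩ := hK.elim_nhds_subcover (fun y => ball y (s y))
    (fun y hy => ball_mem_nhds y (hs0 y (hKD hy)))
  rcases t.eq_empty_or_nonempty with ht | ht
  · -- the cover is empty, hence so is `K`
    refine ⟨1, one_pos, le_rfl, 1, le_rfl, ?_⟩
    intro _ _ _ _ _ _ _ _ z hz
    have hz' := hcover hz
    rw [ht] at hz'
    simp at hz'
  · -- the least exponent and the largest constant over the finite cover
    obtain ⟨y₀, hy₀t, hy₀⟩ := t.exists_min_image θ ht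
    obtain ⟨y₁, hy₁t, hy₁⟩ := t.exists_max_image C ht
    have hy₀D : y₀ ∈ D := hKD (htK y₀ hy₀t)
    have hy₁D : y₁ ∈ D := hKD (htK y₁ hy₁t)
    refine ⟨θ y₀, hθ0 y₀ hy₀D, hθ1 y₀ hy₀D, C y₁, hC1 y₁ hy₁D, ?_⟩
    intro u B ε hloc hε hεB hB hsmall z hz
    have hB0 : 0 < B := lt_of_lt_of_le hε hεB
    obtain ⟨y, hyt, hzy⟩ := mem_iUnion₂.1 (hcover hz)
    have hyD : y ∈ D := hKD (htK y hyt)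
    calc |u z| ≤ C y * ε ^ θ y * B ^ (1 - θ y) := hP y hyD u B ε hloc hε hεB hB hsmall z hzy
      _ = C y * (ε ^ θ y * B ^ (1 - θ y)) := mul_assoc _ _ _
      _ ≤ C y₁ * (ε ^ θ y₀ * B ^ (1 - θ y₀)) :=
          mul_le_mul (hy₁ y hyt) (rpow_interp_antitone hε hεB (hy₀ y hyt))
            (mul_nonneg (Real.rpow_nonneg hε.le _) (Real.rpow_nonneg hB0.le _))
            (zero_le_one.trans (hC1 y₁ hy₁D))
      _ = C y₁ * ε ^ θ y₀ * B ^ (1 - θ y₀) := (mul_assoc _ _ _).symm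

end Summit.QuantumFields.YangMills.Theorems.FreeEnergyWindowChannel
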